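import Literature.Analysis.DeBrangesSpaces.Basic
import Mathlib.LinearAlgebra.LinearIndependent.Lemmas
import HarnessLib

/-!
# de Branges 1986, Theorems 6 and 7: the positivity condition for `𝓗(E)` (as printed)

LABEL: RH-FREE. Conditional theorems about a GENERAL de Branges structure function `E`; the
positivity condition is a HYPOTHESIS, never asserted for any particular `E`. bears_on: B-C/B-P
(LADDER-RH §1, COLUMN 6 DBR). WHAT THIS IS NOT: not a statement about `ζ` or RH — for the
structure function `E(z) = ξ(1 − iz)` of the Riemann zeta function the positivity hypothesis of
Theorem 6 is REFUTED (Conrey–Li 2000, kernel theorems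
`Literature.Barriers.RiemannHypothesis.ConreyLi2000_HE_holds`, `ConreyLi2000_FW_holds`,
`DeBrangesPositivity_holds`); typing de Branges' conditional theorems is transcription, not
progress toward RH; nothing here bears on the truth of RH.

Source: L. de Branges, *The Riemann hypothesis for Hilbert spaces of entire functions*, Bull.
Amer. Math. Soc. (N.S.) 15 (1986), 1–17 [deBranges1986], section "The Riemann hypothesis",
pp. 14–17 (read: materialised text `paper:url-012807b01c95`, pages p0014–p0017; the vocabulary of
p. 3). Verbatim (p. 14, l. 41–45):

> THEOREM 6. Assume that `𝓗(E)` is a given space such that `E(z − i)` and `E*(z)` are linearly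
> dependent. If the real part of `(F(t + i), F(t))` is nonnegative whenever `F(z)` is an element
> of the space such that `F(z + i)` belongs to the space, then every zero `w` of `E(z)` such that
> neither `w` nor `w + i` is real, and such that `E(w + i)` is not equal to `E(w − i)`, is simple
> and lies on the line `w̄ = w + i`.

(p. 16, l. 17–21, the strict form, stated without proof:)

> If the stronger hypothesis is made that the real part of `(F(t + i), F(t))` is positive
> whenever `F(z)` is a nonzero element of the space such that `F(z + i)` belongs to the space,
> then `E(z)` has no zero `w` such that `w` or `w + i` is real or such that `E(w + i) = E(w − i)`.
> This stronger hypothesis holds if sufficiently many zeros of `E(z)` are simple and lie on the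
> desired line.

(p. 16, l. 22–32:)

> THEOREM 7. Assume that `𝓗(E)` is a given space such that `E(z − i)` and `E*(z)` are linearly
> dependent and such that the real part of `(F(t + i), F(t))` is nonnegative whenever `F(z)` is an
> element of the space such that `F(z + i)` belongs to the space. If every element of the space
> belongs to the closed span of the functions of the form `E(z)/(z − w)`, where `w` is a zero of
> `E(z)` such that neither `w` nor `w + i` is real and such that `E(w + i)` is not equal to
> `E(w − i)`, then the real part of `(F(t + i), F(t))` is positive whenever `F(z)` is a nonzero
> element of the space such that `F(z + i)` belongs to the space.

(p. 17, l. 2–4, the closing CONJECTURE — recorded here as a remark ONLY, never as a fact:)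

> The hypotheses of Theorems 6 and 7 are conjectured to apply to the function `E_χ(a, z)` when
> `χ` is a primitive even character modulo `r`, `r` not one, and `a = 1`.

(`E_χ(a, z) = a^{−iz} (π/r)^{−(1−iz)/2} Γ((1 − iz)/2) ζ_χ(1 − iz)`, p. 12 l. 25–29. Status in
print of the analogous positivity conditions: refuted for `ζ` itself — the `r = 1` structure
function `ξ(1 − iz)` — and for `L(s, χ₄)` by Conrey–Li 2000 §3, and in the `𝓕(W_χ)`-form for
every primitive `χ` (Conrey–Li 2000 §4, Sarnak); see
`Literature/Barriers/RiemannHypothesis/DeBrangesPositivity*.lean`. The conjecture is not a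
Literature fact (conventions: conjectures are route items / docstring remarks).)

## Rendering (the tree's vocabulary, `Literature/Analysis/DeBrangesSpaces/Basic.lean`)

* "`𝓗(E)` is a given space": `E` is an entire function with `|E(x − iy)| < |E(x + iy)|` for
  `y > 0` (p. 3, l. 11–13) = `IsHermiteBiehler E`. de Branges does NOT assume that `E` has no
  real zeros, and does NOT assume that `|E(x + iy)|` is increasing in `y` (both are extra
  hypotheses of Conrey–Li's Theorem 1, `conreyLi2000_thm1`).
* "`F(z)` is an element of the space" (p. 3, l. 17–21): `F` entire, `‖F‖² = ∫ |F(t)/E(t)|² dt`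
  finite, and `|F(z)|² ≤ ‖F‖² K(z, z)` for all complex `z` — this is `DeBranges1986.Mem E F`,
  literally the membership triple `Differentiable ℂ F ∧ Integrable ‖F x / E x‖² ∧
  HasKernelBound E F` inlined in `conreyLi2000_thm1` (Conrey–Li's (2.1) is de Branges' p. 3
  definition). As in `Basic.lean`, the kernel bound is imposed at non-real `z` (at real points it
  is the limiting case). It is NOT the tree's `DeBrangesSpace E` (Romanov's characterisation with
  an existential constant), cf. the header of `DeBrangesPositivity.lean`.
* "`E(z − i)` and `E*(z)` are linearly dependent": `DeBranges1986.ShiftLinDep E :=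
  ¬ LinearIndependent ℂ ![fun z ↦ E (z − i), sharp E]` (`E* = sharp E`), unfolded by
  `shiftLinDep_iff`. For `E ≢ 0` this is Conrey–Li's `E♯(z) = ε E(z − i)` with `|ε| = 1`
  (proved in the Proofs file: `ε ≠ 0` by dependence, `|ε| = 1` by applying `♯` twice).
* "`(F(t + i), F(t))`": de Branges' scalar product is linear in the first variable
  (`F(w) = (F(t), K(w, t))`, p. 3 l. 24) = `deBrangesInner E`; the printed argument ORDER is
  kept: `deBrangesInner E (fun z ↦ F (z + I)) F` (Conrey–Li (3.1) print `⟨F, F(· + i)⟩`; the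
  real parts agree by Hermitian symmetry — `DeBranges1986PositivityProofs.lean`).
* "neither `w` nor `w + i` is real, and `E(w + i) ≠ E(w − i)`": `DeBranges1986.IsAdmissibleZero`
  — the EXCEPTIONAL-ZERO CAVEAT of the printed statement is kept verbatim (de Branges, p. 14
  l. 21–32: linear dependence alone only places the zeros in `−1 ≤ Im w ≤ 0` symmetrically about
  `Im w = −1/2`; "No analogue of the Riemann hypothesis is true when no further condition is
  imposed").
* "simple and lies on the line `w̄ = w + i`": `deriv E w ≠ 0 ∧ conj w = w + I` (`Im w = −1/2`).
* "belongs to the closed span of the functions `E(z)/(z − w)`" (closure in the metric of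
  `𝓗(E)`): `DeBranges1986.InClosedSpan E F` — for every `δ > 0` some finite linear combination
  of the functions `z ↦ E z / (z − w)`, `w` admissible zeros, is `δ`-close to `F` in
  `deBrangesNormSq E` (only real-axis values enter the norm; the junk value of `E z / (z − w)` at
  `z = w ∉ ℝ` is immaterial).

## Hypothesis delta: de Branges 1986 Thm 6 versus Conrey–Li 2000 Thm 1 (`conreyLi2000_thm1`)

(Δ1) CL add "`E` has no real zeros"; dB allows real zeros and excludes them from the conclusion.
(Δ2) CL add "`|E(x + iy)|` strictly increasing in `y > 0`"; dB has no such hypothesis and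
instead excludes the zeros with `E(w + i) = E(w − i)` from the conclusion (CL use monotonicity
exactly to place these zeros on the line `Im w = −1/2`; it does not exclude them). (Δ3) "linearly dependent" (dB) versus `E♯ = ε E(· − i)`, `|ε| = 1`
(CL): equivalent for `E ≢ 0`. (Δ4) The positivity hypothesis is the same (membership dB p. 3 =
CL (2.1); argument order of the scalar product swapped, same real part). (Δ5) Conclusions: dB —
admissible zeros are SIMPLE and on `Im w = −1/2`; CL — ALL zeros on `Im w = −1/2` (no simplicity)
plus `Re conj E′(w) E(w + i)/(2πi) ≥ 0`. de Branges' proof (p. 15–16) in fact gives the strict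
inequality `Re conj E′(w) E(w + i)/(2πi) > 0` at admissible zeros.

## What is here / what is proved where

This module holds the STATEMENTS as printed (named `Prop`s, sorry-free, no axioms):
`deBranges1986_thm6`, `deBranges1986_thm7`, `deBranges1986_strictRemark`, plus the vocabulary
above with unfolding lemmas. Status of the three statements in the tree:
* `deBranges1986_thm6`, `deBranges1986_thm7` are THEOREMS as printed (real zeros of `E`
  allowed): `deBranges1986_thm6_holds`, `deBranges1986_thm7_holds`
  (`DeBranges1986PositivityHolds.lean`). `DeBranges1986PositivityProofs.lean` follows de Branges'
  printed proofs (pp. 15–16) for every structure function with the reproducing property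
  `HasReproducing E` (also giving de Branges' strict kernel positivity
  `Re conj E′(w) E(w + i)/(2πi) > 0` at admissible zeros, `re_kernel_pos_of_isAdmissibleZero`),
  and `ReproducingKernelRealZeros.lean` proves that property for EVERY Hermite–Biehler function
  (`deBrangesInner_deBrangesKernel_of_isHermiteBiehler`: `F/E` has removable singularities at the
  real zeros of `E` by square integrability).
* `deBranges1986_strictRemark` (stated WITHOUT proof in the source) is FALSE as printed:
  `deBranges1986_strictRemark_false` (`DeBranges1986StrictRemarkRefutation.lean`; for
  `E₀(z) = z(z + i)` the shift domain is `{0}`, so strict positivity holds vacuously while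
  `E₀(0) = 0`). Its clause on zeros with `E(w + i) = E(w − i)` holds for every structure function
  (`apply_add_I_ne_of_shiftPos_of_isHermiteBiehler`) and the whole remark holds for structure
  functions without real zeros (`deBranges1986_strictRemark_of_noRealZeros`). Nobody should take
  `(h : deBranges1986_strictRemark)`.

## References

* L. de Branges, Bull. AMS 15 (1986) 1–17, Thms 6–7, pp. 14–17 (read) [deBranges1986].
* J. B. Conrey, X.-J. Li, IMRN 2000:18 = arXiv:math/9812166, §2 Thm 1, §3–4 [ConreyLi2000]
  (tree: `conreyLi2000_thm1_holds`; negatives `ConreyLi2000_HE_holds`, `ConreyLi2000_FW_holds`).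
-/

noncomputable section

open scoped ComplexConjugate Real
open _root_.Complex _root_.MeasureTheory

namespace Literature.Analysis.DeBrangesSpaces

namespace DeBranges1986

/-! ## Vocabulary of de Branges 1986, pp. 3 and 14–16 -/

/-- RH-FREE. **"`F(z)` is an element of the space `𝓗(E)`"** in de Branges' 1986 definition
(p. 3, l. 17–21): `F` is entire, `‖F‖² = ∫ |F(t)/E(t)|² dt` is finite, and
`|F(z)|² ≤ ‖F‖² K(z, z)` (imposed at every non-real `z`, `K(z, z) = deBrangesKernelDiag E z`).
This is literally Conrey–Li's (2.1), the membership triple inlined in `conreyLi2000_thm1`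
(`Mem_iff_conreyLi`); it is not the tree's `DeBrangesSpace E`. [cite: deBranges1986, p. 3] -/
def Mem (E F : ℂ → ℂ) : Prop :=
  Differentiable ℂ F ∧ Integrable (fun x : ℝ => ‖F x / E x‖ ^ 2) ∧ HasKernelBound E F

/-- RH-FREE. **"`F(z)` is an element of the space such that `F(z + i)` belongs to the space"**
(de Branges 1986, Thm 6, p. 14 l. 43): `F ∈ 𝓗(E)` and `F(· + i) ∈ 𝓗(E)` — the domain on which
the positivity condition is imposed. [cite: deBranges1986, Theorem 6] -/
def ShiftMem (E F : ℂ → ℂ) : Prop :=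
  Mem E F ∧ Mem E (fun z => F (z + I))

/-- RH-FREE. **de Branges' scalar product on the shift domain** (p. 15, l. 19–22): "consider
the scalar product defined by `(F(t + i), G(t)) + (F(t), G(t + i))` on elements `F(z)` and `G(z)`
of the space such that `F(z + i)` and `G(z + i)` belong to the space" (linear in `F`; its value on
the diagonal has real part `2 Re (F(t + i), F(t))`). [cite: deBranges1986, p. 15] -/
def shiftForm (E F G : ℂ → ℂ) : ℂ :=
  deBrangesInner E (fun z => F (z + I)) G + deBrangesInner E F (fun z => G (z + I))

/-- RH-FREE. **"`E(z − i)` and `E*(z)` are linearly dependent"** (de Branges 1986, Thm 6,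
p. 14 l. 41–42; `E* = sharp E`), stated with Mathlib's `LinearIndependent` for the pair of
functions `z ↦ E(z − i)`, `E♯`; unfolded in `shiftLinDep_iff`. For `E ≢ 0` it is equivalent to
Conrey–Li's functional identity `E♯(z) = ε E(z − i)` with `|ε| = 1`. [cite: deBranges1986,
Theorem 6] -/
def ShiftLinDep (E : ℂ → ℂ) : Prop :=
  ¬ LinearIndependent ℂ ![fun z : ℂ => E (z - I), sharp E]

/-- RH-FREE. **The positivity HYPOTHESIS of Theorem 6** (p. 14, l. 42–43): "the real part of
`(F(t + i), F(t))` is nonnegative whenever `F(z)` is an element of the space such that `F(z + i)`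
belongs to the space" (printed argument order; `deBrangesInner E` is linear in the first slot).
A hypothesis only — REFUTED for `E(z) = ξ(1 − iz)` (`ConreyLi2000_HE_holds`); never asserted
here for any `E`. [cite: deBranges1986, Theorem 6] -/
def ShiftNonneg (E : ℂ → ℂ) : Prop :=
  ∀ F : ℂ → ℂ, ShiftMem E F → 0 ≤ (deBrangesInner E (fun z => F (z + I)) F).re

/-- RH-FREE. **The strict positivity condition** (p. 16, l. 17–19 and the conclusion of Thm 7):
"the real part of `(F(t + i), F(t))` is positive whenever `F(z)` is a nonzero element of the space
such that `F(z + i)` belongs to the space". A hypothesis / conclusion shape only, never asserted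
for any `E`. [cite: deBranges1986, Theorem 7] -/
def ShiftPos (E : ℂ → ℂ) : Prop :=
  ∀ F : ℂ → ℂ, ShiftMem E F → F ≠ 0 → 0 < (deBrangesInner E (fun z => F (z + I)) F).re

/-- RH-FREE. **The zeros covered by Theorem 6** (p. 14, l. 44–45): a zero `w` of `E` "such that
neither `w` nor `w + i` is real, and such that `E(w + i)` is not equal to `E(w − i)`" — the
printed EXCEPTIONAL-ZERO CAVEAT (without it the statement is false: p. 14 l. 21–32).
[cite: deBranges1986, Theorem 6] -/
def IsAdmissibleZero (E : ℂ → ℂ) (w : ℂ) : Prop :=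
  E w = 0 ∧ w.im ≠ 0 ∧ (w + I).im ≠ 0 ∧ E (w + I) ≠ E (w - I)

/-- RH-FREE. **"`F` belongs to the closed span of the functions `E(z)/(z − w)`"**, `w` ranging
over the admissible zeros (Thm 7, p. 16 l. 25–30), closure in the metric of `𝓗(E)`: for every
`δ > 0` there are finitely many admissible zeros `w ∈ s` and coefficients `a w` with
`‖F − Σ_{w ∈ s} a_w E(·)/(· − w)‖²_{𝓗(E)} < δ`. Only the values on the real axis enter
`deBrangesNormSq`, so the junk value of `E z / (z − w)` at `z = w` (a non-real point) is
immaterial. [cite: deBranges1986, Theorem 7] -/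
def InClosedSpan (E F : ℂ → ℂ) : Prop :=
  ∀ δ : ℝ, 0 < δ → ∃ (s : Finset ℂ) (a : ℂ → ℂ), (∀ w ∈ s, IsAdmissibleZero E w) ∧
    deBrangesNormSq E (fun z => F z - ∑ w ∈ s, a w * (E z / (z - w))) < δ

/-! ### Unfolding lemmas -/

variable {E F : ℂ → ℂ}

/-- `Mem E F` is by definition the membership triple of `conreyLi2000_thm1` (de Branges p. 3 =
Conrey–Li (2.1)). [cite: deBranges1986, p. 3] -/
theorem Mem_iff_conreyLi : Mem E F ↔
    Differentiable ℂ F ∧ Integrable (fun x : ℝ => ‖F x / E x‖ ^ 2) ∧ HasKernelBound E F :=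
  Iff.rfl

/-- Elements of the space are entire. [cite: deBranges1986, p. 3] -/
theorem Mem.differentiable (h : Mem E F) : Differentiable ℂ F := h.1

/-- Elements of the space have `F/E` square integrable on `ℝ`. [cite: deBranges1986, p. 3] -/
theorem Mem.integrable_sq (h : Mem E F) : Integrable (fun x : ℝ => ‖F x / E x‖ ^ 2) := h.2.1

/-- Elements of the space satisfy the kernel bound `|F(z)|² ≤ ‖F‖² K(z, z)`.
[cite: deBranges1986, p. 3] -/
theorem Mem.hasKernelBound (h : Mem E F) : HasKernelBound E F := h.2.2

/-- Unfolding `ShiftMem`. [cite: deBranges1986, Theorem 6] -/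
theorem shiftMem_iff : ShiftMem E F ↔ Mem E F ∧ Mem E (fun z => F (z + I)) := Iff.rfl

/-- **"Linearly dependent", unfolded**: `E(· − i)` and `E♯` are linearly dependent iff
`a E(z − i) + b E♯(z) = 0` identically for some `(a, b) ≠ (0, 0)`. [cite: deBranges1986,
Theorem 6] -/
theorem shiftLinDep_iff : ShiftLinDep E ↔
    ∃ a b : ℂ, ¬ (a = 0 ∧ b = 0) ∧ ∀ z : ℂ, a * E (z - I) + b * sharp E z = 0 := by
  unfold ShiftLinDep
  rw [LinearIndependent.pair_iff]
  constructor
  · intro h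
    push Not at h
    obtain ⟨a, b, hab, hne⟩ := h
    refine ⟨a, b, fun h0 => hne h0.1 h0.2, fun z => ?_⟩
    have := congrFun hab z
    simpa using this
  · rintro ⟨a, b, hne, hz⟩ h
    apply hne
    refine h a b ?_
    funext z
    simpa using hz z

/-- Conrey–Li's functional identity `E♯(z) = ε E(z − i)` (any constant `ε`) is a linear
dependence in de Branges' sense. [cite: deBranges1986, Theorem 6] -/
theorem shiftLinDep_of_sharp_eq {ε : ℂ} (h : ∀ z : ℂ, sharp E z = ε * E (z - I)) :
    ShiftLinDep E :=
  shiftLinDep_iff.2 ⟨ε, -1, by simp, fun z => by rw [h z]; ring⟩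

/-- The strict condition implies the non-strict one (at `F = 0` the scalar product vanishes).
[cite: deBranges1986, p. 16] -/
theorem ShiftPos.shiftNonneg (h : ShiftPos E) : ShiftNonneg E := by
  intro F hF
  by_cases hF0 : F = 0
  · subst hF0
    simp [deBrangesInner]
  · exact (h F hF hF0).le

/-- On the shift domain, de Branges' form on the diagonal is twice the real part of
`(F(t + i), F(t))` in real part: `Re [F, F] = 2 Re (F(t + i), F(t))` needs Hermitian symmetry of
`deBrangesInner` and is proved in the Proofs file; here only the definitional unfolding.
[cite: deBranges1986, p. 15] -/
theorem shiftForm_apply (E F G : ℂ → ℂ) : shiftForm E F G =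
    deBrangesInner E (fun z => F (z + I)) G + deBrangesInner E F (fun z => G (z + I)) := rfl

/-- An admissible zero is a zero. [cite: deBranges1986, Theorem 6] -/
theorem IsAdmissibleZero.eq_zero {w : ℂ} (h : IsAdmissibleZero E w) : E w = 0 := h.1

/-- "On the line `w̄ = w + i`" (Thm 6, p. 14 l. 45) means `Im w = −1/2`. [cite: deBranges1986,
Theorem 6] -/
theorem conj_eq_add_I_iff {w : ℂ} : conj w = w + I ↔ w.im = -1 / 2 := by
  constructor
  · intro h
    have := congrArg Complex.im h
    simp only [Complex.conj_im, Complex.add_im, Complex.I_im] at this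
    linarith
  · intro h
    apply Complex.ext
    · simp
    · simp [h]
      norm_num

end DeBranges1986

open DeBranges1986

/-! ## The printed statements -/

/-- RH-FREE (conditional theorem over a general structure function; the positivity hypothesis is
REFUTED for `E = ξ(1 − i·)`, `ConreyLi2000_HE_holds`). **de Branges 1986, Theorem 6, as
printed** (p. 14, l. 41–45): let `E` be a de Branges structure function (`IsHermiteBiehler E`;
real zeros allowed, no monotonicity assumed) such that `E(z − i)` and `E♯(z)` are linearly
dependent; IF `Re (F(t + i), F(t))_{𝓗(E)} ≥ 0` for every element `F` of the space with
`F(· + i)` in the space, THEN every zero `w` of `E` with `w ∉ ℝ`, `w + i ∉ ℝ` and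
`E(w + i) ≠ E(w − i)` is SIMPLE (`E′(w) ≠ 0`) and lies on the line `w̄ = w + i`
(`Im w = −1/2`). Hypothesis delta versus `conreyLi2000_thm1`: see the module docstring (Δ1)–(Δ5).
PROVED as printed: `deBranges1986_thm6_holds` (`DeBranges1986PositivityHolds.lean`).
[cite: deBranges1986, Theorem 6] -/
def deBranges1986_thm6 : Prop :=
  ∀ E : ℂ → ℂ, IsHermiteBiehler E → ShiftLinDep E → ShiftNonneg E →
    ∀ w : ℂ, IsAdmissibleZero E w → deriv E w ≠ 0 ∧ conj w = w + I

/-- RH-FREE (conditional theorem; same standing hypotheses as Theorem 6). **de Branges 1986,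
Theorem 7, as printed** (p. 16, l. 22–32): let `E` be a structure function with `E(z − i)`,
`E♯(z)` linearly dependent and `Re (F(t + i), F(t)) ≥ 0` on the shift domain; IF every element of
`𝓗(E)` belongs to the closed span of the functions `E(z)/(z − w)`, `w` running over the zeros of
`E` with `w, w + i ∉ ℝ` and `E(w + i) ≠ E(w − i)`, THEN `Re (F(t + i), F(t)) > 0` for every
nonzero element `F` of the space with `F(· + i)` in the space. (Printed proof, p. 16 l. 33–43:
`Re (F(t+i), F(t)) = 0` forces `F(w + i) = 0` at each such `w` by the proof of Theorem 6, i.e.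
`F ⊥ K(w + i, ·) = const · E(z)/(z − w)`, so `F = 0` by density.) PROVED as printed:
`deBranges1986_thm7_holds` (`DeBranges1986PositivityHolds.lean`). [cite: deBranges1986, Theorem 7] -/
def deBranges1986_thm7 : Prop :=
  ∀ E : ℂ → ℂ, IsHermiteBiehler E → ShiftLinDep E → ShiftNonneg E →
    (∀ F : ℂ → ℂ, Mem E F → InClosedSpan E F) → ShiftPos E

/-- RH-FREE (conditional; stated WITHOUT PROOF in the source). **de Branges 1986, the strict
form of Theorem 6** (p. 16, l. 17–20): under the standing hypotheses of Theorem 6, "if the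
stronger hypothesis is made that the real part of `(F(t + i), F(t))` is positive whenever `F(z)`
is a nonzero element of the space such that `F(z + i)` belongs to the space, then `E(z)` has no
zero `w` such that `w` or `w + i` is real or such that `E(w + i) = E(w − i)`" — i.e. every zero
is admissible (hence, with Theorem 6, simple and on `Im w = −1/2`). STATUS: FALSE AS PRINTED —
`deBranges1986_strictRemark_false` (`DeBranges1986StrictRemarkRefutation.lean`): for
`E₀(z) = z(z + i)` (a structure function with `E₀♯ = E₀(· − i)`) the shift domain is `{0}`, so
the strict positivity hypothesis holds vacuously, while `E₀(0) = 0` is a real zero. Nobody should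
take `(h : deBranges1986_strictRemark)`. What holds: the clause about zeros with
`E(w + i) = E(w − i)` for every structure function (`apply_add_I_ne_of_shiftPos_of_isHermiteBiehler`:
the kernel function `K(w, ·)` is a nonzero element of the shift domain on which the form
vanishes), and the whole remark for `E` without real zeros, where the clauses "`w` real",
"`w + i` real" are vacuous (`deBranges1986_strictRemark_of_noRealZeros`). Kept as typed (the
printed sentence, negative knowledge attached) rather than silently strengthened with a
non-degeneracy hypothesis the source does not state. [cite: deBranges1986, p. 16] -/
def deBranges1986_strictRemark : Prop :=
  ∀ E : ℂ → ℂ, IsHermiteBiehler E → ShiftLinDep E → ShiftPos E →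
    ∀ w : ℂ, E w = 0 → IsAdmissibleZero E w

end Literature.Analysis.DeBrangesSpaces

end
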